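import Mathlib
import Summits.NavierStokesRegularity.OSWSelfSimilar.SheetNSLineTorusCascadeExactHead
import Summits.NavierStokesRegularity.OSWSelfSimilar.SheetNSLineTorusCascadeLinkCertified
import HarnessLib

/-!
# Viscous CLM on the torus (`a = 0`, `σ = 2`): the DATUM-FREE head/tail certificate with FOUR exact head modes — for every `c ≥ 27ν`
# the sine cascade is unbounded at `t = log 2/ν` and NO classical solution of the MODEL PDE from `−c sin x` exists on `[0, log 2/ν]`

HONEST FRAMING (cell ns-blowup GROUP B «PROFILE SEARCH», zone Z3, row Z3-U addendum A-F2 of `HOME/profile/z3/CENSUS-Z3.md`;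
human rulings D-0035/D-0074; Z3-TWIN lineage): **1-D MODEL (viscous Constantin–Lax–Majda equation `ω_t = ω Hω + ν ω_xx` on `𝕋`,
`H = hilbertTransformCircle`); exact ODE algebra + rational arithmetic, kernel-checked end to end; not Euler, not Navier–Stokes;
«violates: none — MODEL». NO script datum: every inequality below is verified by `norm_num` on rationals.**

WHAT. Same architecture as `SheetNSLineTorusCascadeKernelThirtyOne` (`k₀ = 3`, `31ν`) with the fourth head mode in closed form
(`E_4 = x⁴ g₄(x²)`, `g₄(u) = 7/1152 − u/80 + u²/256 + u³/288 − 11u⁶/11520` antitone on `[0,1]`; `SheetNSLineTorusCascadeExactHead` v2):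
`unbounded_of_universal_static_base` (p516509) with `k₀ = 4` and the rational instance `A = 321/20`, `λ₁ = 1/27`, `α = log(5/4)`, `T = log 2`,
`L = 4 log(8/5)` (`e^{−L} = (5/8)⁴`, `α + L/4 = T`), `ζ_1 = 1589/10000`, `ζ_2 = ζ_3 = ζ_4 = 0`, the window `e^{−s} ∈ [1/2, 4/5]` cut at
`{19/25, 71/100, 13/20, 59/100, 27/50}` (`windows27`); the twenty-four rational inequalities close by `norm_num` (tightest: mode 1 at the
far end `0.49999 ≤ 1/2`, mode 2 on the last piece `0.04403 ≤ 0.0442 ≤ 0.04427`, the fixed point `12 ≤ 12.0196`).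

* `windows27`, `base27`;
* **`unbounded_of_le_twentySeven`** — every sine cascade with `0 < ν`, `27ν ≤ c` has `k ↦ e_k(log 2/ν)` unbounded above;
  `datum_lt_twentySeven_of_bounded` (census form);
* **`horizon_lt_log_two_of_le_twentySeven`** — PDE level: every classical `2π`-periodic solution of the MODEL PDE on `[0, T′]` with
  `ω(0,·) = −c sin`, `0 < ν`, `27ν ≤ c`, has `T′ < log 2/ν`; `datum_lt_twentySeven_of_classicalSolution` (census form).
READING: datum-free kernel sentence for sine data: «global + unique classical solution for c < 12ν (eng-3); NO classical solution on
[0, log 2/ν] for c ≥ 27ν» (48ν eng-3 → 31ν → 27ν; `k₀ = 6` would give ≈ 23ν at the price of the closed forms `E_5`, `E_6`); located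
threshold `19.7756ν`; certified script+kernel bracket `[19.7755478, 19.7766876]ν`. bears_on: LADDER-NS N5 / zone Z3 (row Z3-U) → N1
linear core. WHAT THIS IS NOT: not NS; no definitions; nothing numerical outside the kernel.
-/

namespace Summit.NavierStokesRegularity.OSWSelfSimilar
namespace SheetNSLineTorusCascade

open Finset Real Set

variable {ν c : ℝ} {e : ℕ → ℝ → ℝ}

/-! ### The window `[log(5/4), log 2]` in six pieces -/

/-- `−log(4/5) = log(5/4)`. -/
private theorem neg_log_four_fifths : -Real.log (4 / 5) = Real.log (5 / 4) := by
  rw [← Real.log_inv]; norm_num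

/-- `−log(1/2) = log 2`. -/
private theorem neg_log_half' : -Real.log (1 / 2) = Real.log 2 := by
  rw [← Real.log_inv]; norm_num

/-- On `[log(5/4), log 2]` the variable `x = e^{−s}` lies in one of six rational pieces of `[1/2, 4/5]`. -/
theorem windows27 {s : ℝ} (hs : s ∈ Icc (Real.log (5 / 4)) (Real.log 2)) :
    ((19 / 25 : ℝ) ≤ exp (-s) ∧ exp (-s) ≤ 4 / 5) ∨ ((71 / 100 : ℝ) ≤ exp (-s) ∧ exp (-s) ≤ 19 / 25) ∨
    ((13 / 20 : ℝ) ≤ exp (-s) ∧ exp (-s) ≤ 71 / 100) ∨ ((59 / 100 : ℝ) ≤ exp (-s) ∧ exp (-s) ≤ 13 / 20) ∨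
    ((27 / 50 : ℝ) ≤ exp (-s) ∧ exp (-s) ≤ 59 / 100) ∨ ((1 / 2 : ℝ) ≤ exp (-s) ∧ exp (-s) ≤ 27 / 50) := by
  have hhi : exp (-s) ≤ 4 / 5 :=
    exp_neg_le_of_neg_log_le (by norm_num) (by rw [neg_log_four_fifths]; exact hs.1)
  have hlo : (1 / 2 : ℝ) ≤ exp (-s) := le_exp_neg_of_le_neg_log (by norm_num) (by rw [neg_log_half']; exact hs.2)
  rcases le_total s (-Real.log (19 / 25)) with h1 | h1
  · exact Or.inl ⟨le_exp_neg_of_le_neg_log (by norm_num) h1, hhi⟩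
  rcases le_total s (-Real.log (71 / 100)) with h2 | h2
  · exact Or.inr (Or.inl ⟨le_exp_neg_of_le_neg_log (by norm_num) h2, exp_neg_le_of_neg_log_le (by norm_num) h1⟩)
  rcases le_total s (-Real.log (13 / 20)) with h3 | h3
  · exact Or.inr (Or.inr (Or.inl ⟨le_exp_neg_of_le_neg_log (by norm_num) h3, exp_neg_le_of_neg_log_le (by norm_num) h2⟩))
  rcases le_total s (-Real.log (59 / 100)) with h4 | h4
  · exact Or.inr (Or.inr (Or.inr (Or.inl
      ⟨le_exp_neg_of_le_neg_log (by norm_num) h4, exp_neg_le_of_neg_log_le (by norm_num) h3⟩)))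
  rcases le_total s (-Real.log (27 / 50)) with h5 | h5
  · exact Or.inr (Or.inr (Or.inr (Or.inr (Or.inl
      ⟨le_exp_neg_of_le_neg_log (by norm_num) h5, exp_neg_le_of_neg_log_le (by norm_num) h4⟩))))
  · exact Or.inr (Or.inr (Or.inr (Or.inr (Or.inr ⟨hlo, exp_neg_le_of_neg_log_le (by norm_num) h5⟩))))

/-! ### The head base (`k₀ = 4`, `A = 321/20`, `λ₁ = 1/27`, `ζ_1 = 1589/10000`) -/

/-- **THE HEAD BASE, IN THE KERNEL.** For `j ≤ 4` and `s ∈ [log(5/4), log 2]`: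
`(321/20)·j·(1/27)^j·(1 − ζ_j) ≤ E_j(s)` with `ζ_1 = 1589/10000`, `ζ_j = 0` otherwise. [new here — MODEL] -/
theorem base27 (j : ℕ) (hj : j ≤ 4) {s : ℝ} (hs : s ∈ Icc (Real.log (5 / 4)) (Real.log 2)) :
    (321 / 20 : ℝ) * (j : ℝ) * (1 / 27 : ℝ) ^ j * (1 - (if j = 1 then (1589 / 10000 : ℝ) else 0))
      ≤ cascadeSolution 1 (sineDatum 1) j s := by
  have hlo : (1 / 2 : ℝ) ≤ exp (-s) := le_exp_neg_of_le_neg_log (by norm_num) (by rw [neg_log_half']; exact hs.2)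
  interval_cases j
  · simp
  · have h1 := univ_one_ge hlo
    have hnum : (321 / 20 : ℝ) * ((1 : ℕ) : ℝ) * (1 / 27 : ℝ) ^ 1 * (1 - (if 1 = 1 then (1589 / 10000 : ℝ) else 0)) ≤ 1 / 2 := by
      norm_num
    linarith
  · have hnum : (321 / 20 : ℝ) * ((2 : ℕ) : ℝ) * (1 / 27 : ℝ) ^ 2 * (1 - (if 2 = 1 then (1589 / 10000 : ℝ) else 0))
        ≤ 221 / 5000 := by
      norm_num
    refine le_trans hnum ?_
    rcases windows27 hs with ⟨hb, ha⟩ | ⟨hb, ha⟩ | ⟨hb, ha⟩ | ⟨hb, ha⟩ | ⟨hb, ha⟩ | ⟨hb, ha⟩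
    all_goals exact le_trans (by norm_num) (univ_two_ge (by norm_num) hb ha (by norm_num))
  · have hnum : (321 / 20 : ℝ) * ((3 : ℕ) : ℝ) * (1 / 27 : ℝ) ^ 3 * (1 - (if 3 = 1 then (1589 / 10000 : ℝ) else 0))
        ≤ 1 / 400 := by
      norm_num
    refine le_trans hnum ?_
    rcases windows27 hs with ⟨hb, ha⟩ | ⟨hb, ha⟩ | ⟨hb, ha⟩ | ⟨hb, ha⟩ | ⟨hb, ha⟩ | ⟨hb, ha⟩
    all_goals exact le_trans (by norm_num) (univ_three_ge (by norm_num) hb ha (by norm_num))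
  · have hnum : (321 / 20 : ℝ) * ((4 : ℕ) : ℝ) * (1 / 27 : ℝ) ^ 4 * (1 - (if 4 = 1 then (1589 / 10000 : ℝ) else 0))
        ≤ 1 / 8000 := by
      norm_num
    refine le_trans hnum ?_
    rcases windows27 hs with ⟨hb, ha⟩ | ⟨hb, ha⟩ | ⟨hb, ha⟩ | ⟨hb, ha⟩ | ⟨hb, ha⟩ | ⟨hb, ha⟩
    all_goals exact le_trans (by norm_num) (univ_four_ge (by norm_num) hb ha (by norm_num))

/-! ### The datum-free theorems -/

/-- `e^{−4 log(8/5)} = (5/8)⁴`. -/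
private theorem exp_neg_L27 : exp (-(4 * Real.log (8 / 5))) = (5 / 8 : ℝ) ^ 4 := by
  have h : -(4 * Real.log (8 / 5)) = ((4 : ℕ) : ℝ) * Real.log (5 / 8) := by
    rw [show (5 / 8 : ℝ) = (8 / 5)⁻¹ by norm_num, Real.log_inv]
    push_cast
    ring
  rw [h, Real.exp_nat_mul, Real.exp_log (by norm_num)]

/-- `log(5/4) + (4 log(8/5))/4 = log 2` (the window closes exactly at `T = log 2`). -/
private theorem window_end27 : Real.log (5 / 4) + 4 * Real.log (8 / 5) / ((4 : ℕ) : ℝ) = Real.log 2 := by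
  have h : Real.log (5 / 4) + Real.log (8 / 5) = Real.log 2 := by
    rw [← Real.log_mul (by norm_num) (by norm_num)]
    norm_num
  push_cast
  linarith [h]

/-- **FINITE-TIME BLOW-UP FOR `c ≥ 27ν`, DATUM-FREE (coefficient form).** For every sine cascade with `0 < ν` and `27ν ≤ c` the
sequence `k ↦ e_k(log 2/ν)` is unbounded above (head/tail certificate with `k₀ = 4`, head base `base27` verified in the kernel).
[new here — MODEL] -/
theorem unbounded_of_le_twentySeven (he : IsSineCascade ν c e) (hν : 0 < ν) (hc : 27 * ν ≤ c) :
    ∀ M : ℝ, ∃ k : ℕ, M < e k (Real.log 2 / ν) := by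
  have hα : 0 ≤ Real.log (5 / 4) := Real.log_nonneg (by norm_num)
  have hL : 0 < 4 * Real.log (8 / 5) := mul_pos (by norm_num) (Real.log_pos (by norm_num))
  have hζ0 : ∀ j : ℕ, 0 ≤ (fun j : ℕ => if j = 1 then (1589 / 10000 : ℝ) else 0) j := by
    intro j; simp only; split_ifs <;> norm_num
  have hζ1 : ∀ j : ℕ, (fun j : ℕ => if j = 1 then (1589 / 10000 : ℝ) else 0) j ≤ 1 := by
    intro j; simp only; split_ifs <;> norm_num
  have hζsupp : ∀ j : ℕ, 4 < j → (fun j : ℕ => if j = 1 then (1589 / 10000 : ℝ) else 0) j = 0 := by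
    intro j hj
    have : j ≠ 1 := by omega
    simp [this]
  have hZ : ∀ n : ℕ, ∑ j ∈ range (n + 1), (j : ℝ) * (fun j : ℕ => if j = 1 then (1589 / 10000 : ℝ) else 0) j
      ≤ 1589 / 10000 := by
    intro n
    simp only [mul_ite, mul_zero]
    rw [Finset.sum_ite_eq']
    split_ifs <;> norm_num
  have hZk : 1 + 12 * (1589 / 10000 : ℝ) ≤ (((4 : ℕ) : ℝ) + 1) ^ 2 := by norm_num
  have hAL : 12 ≤ (321 / 20 : ℝ) * (1 - exp (-(4 * Real.log (8 / 5))))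
      * (1 - (1 + 12 * (1589 / 10000 : ℝ)) / (((4 : ℕ) : ℝ) + 1) ^ 2) := by
    rw [exp_neg_L27]; norm_num
  have hc' : ν ≤ (1 / 27 : ℝ) * c := by linarith
  have ht : Real.log 2 / ν ∈ Icc ((Real.log (5 / 4) + 4 * Real.log (8 / 5) / ((4 : ℕ) : ℝ)) / ν) (Real.log 2 / ν) := by
    rw [window_end27]
    exact ⟨le_rfl, le_rfl⟩
  exact unbounded_of_universal_static_base (by norm_num : (0 : ℝ) < 321 / 20) (by norm_num : (0 : ℝ) < 1 / 27) hα hL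
    (by norm_num : 1 ≤ 4) (fun j : ℕ => if j = 1 then (1589 / 10000 : ℝ) else 0) hζ0 hζ1 hζsupp hZ hZk hAL
    (fun j hj s hs => base27 j hj hs) hν hc' he ht

/-- **Contrapositive (census form).** A sine cascade bounded in `k` at `t = log 2/ν` (`ν > 0`) has `c < 27ν`. [new here — MODEL] -/
theorem datum_lt_twentySeven_of_bounded (he : IsSineCascade ν c e) (hν : 0 < ν)
    (hbdd : ∃ M : ℝ, ∀ k : ℕ, e k (Real.log 2 / ν) ≤ M) : c < 27 * ν := by
  by_contra h
  obtain ⟨M, hM⟩ := hbdd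
  obtain ⟨k, hk⟩ := unbounded_of_le_twentySeven he hν (not_lt.mp h) M
  exact absurd (hM k) (not_le.mpr hk)

/-- **PDE LEVEL, DATUM-FREE: no classical `2π`-periodic solution of `ω_t = ω·Hω + ν ω_xx` from `−c sin x` with `c ≥ 27ν` exists on
`[0, log 2/ν]`** (eng-3's `horizon_lt_log_two_div`: `48ν`; `…KernelThirtyOne`: `31ν`). [new here — MODEL] -/
theorem horizon_lt_log_two_of_le_twentySeven {T : ℝ} {ω ωt ωx ωxx : ℝ → ℝ → ℝ} (h : IsClassicalSolution ν T ω ωt ωx ωxx)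
    (hω0 : ∀ x, ω 0 x = -c * Real.sin x) (hν : 0 < ν) (hc : 27 * ν ≤ c) : T < Real.log 2 / ν :=
  horizon_lt_of_cascade_unbounded h hω0 (div_pos (Real.log_pos (by norm_num)) hν)
    fun e he => unbounded_of_le_twentySeven he hν hc

/-- **Census form at the PDE level:** a classical solution from `−c sin x` that exists on `[0, T]` with `log 2/ν ≤ T` (`ν > 0`) has
`c < 27ν`. [new here — MODEL] -/
theorem datum_lt_twentySeven_of_classicalSolution {T : ℝ} {ω ωt ωx ωxx : ℝ → ℝ → ℝ}
    (h : IsClassicalSolution ν T ω ωt ωx ωxx) (hω0 : ∀ x, ω 0 x = -c * Real.sin x) (hν : 0 < ν)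
    (hT : Real.log 2 / ν ≤ T) : c < 27 * ν := by
  by_contra hcon
  exact absurd hT (not_le.mpr (horizon_lt_log_two_of_le_twentySeven h hω0 hν (not_lt.mp hcon)))

end SheetNSLineTorusCascade
end Summit.NavierStokesRegularity.OSWSelfSimilar
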